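import Summits.AtomisticToContinuum.Crystallization.Theorems.FrustratedLawDichotomyHalfCap
import Summits.AtomisticToContinuum.Crystallization.Theorems.FrustratedLawDichotomyLinkCert

/-!
# FrustratedLawDichotomy · crux `AperiodicFrustratedLawGap` (stmt-AtomisticToContinuum-27623) — THE ℚ-MIRROR OF «CAP MATCH» and
# `P = CapForcing` FROM FINITE CERTIFICATES; the whole geometric side of the dichotomy column as finite statements
# (decomp-a2c, prover hand 2, gen 9)

With `NoTwistCert` (p822065) every corner `w` of a square `{a, w, b, w''}` of the link of `i` yields a HALF-CAP `m_w ∼ τ a, τ b, τ w`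
(`FrustratedLawDichotomyHalfCap`).  `Capped` wants ONE site bonded to all four vertices: the half-caps from the two corners `w, w''` must
COINCIDE.  This is the last metric step of P; here it is typed as a FINITE statement and the whole of P is reduced to finite certificates:

`CapMatchCert θ Pat` := for the centre's link `p : Pat → ℝ³` (unit `nn_i = 1`), a square `{a, w₁, b, w₂}` (`dist a b = √2`, `w₁ ≠ w₂` its
common contacts) and two points `m₁, m₂ ∉ {0} ∪ range p` with coupled bond windows `m₁ ∼ p a, p b, p w₁`, `m₂ ∼ p a, p b, p w₂` on the
cluster `K = {0} ∪ range p ∪ {m₁, m₂}`, the link's own windows / non-bond strictness, non-bonds `0–m₁`, `0–m₂` (strictness), and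
«window ∨ strictness» for the undetermined pairs `m_k–p u` and `m₁–m₂`:  `m₁ = m₂`.

* `capForcingAt_of_certs` : `NoTwistCert θ Pat fcc → NoTwistCert θ Pat hcp → CapMatchCert θ Pat →` (pattern facts of `Pat`: contact
  separation; every diagonal pair has exactly two common contacts) `→ CapForcingAt θ Pat`;
* `capForcing_of_certs` : the six certificates (`NoTwistCert θ P P'`, `P, P' ∈ {fcc, hcp}`; `CapMatchCert θ fcc/hcp`) ⟹ `CapForcing θ`;
* ★ `kr2Shape_of_finiteCerts` : `LinkCert(1/100)` ∧ the six P-certificates ∧ `CappedCert(1/100, 1/20, fcc/hcp)` ⟹ `KR2Shape` — the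
  GEOMETRIC SIDE of the FLD column `FDG ⟸ 14231 ∧ KR2_shape` is now a conjunction of NINE FINITE certificate statements; by name
  `aperiodicFrustratedLawGap_of_finiteCerts` (crux, given `MuEquilibriumDoor ∧ ChargedEnergyGap`), `noFrustratedPeriodicMinimiser_of_finiteCerts`.
`[folklore]` bookkeeping; no `sorry`; no `instance`/`notation`.
-/

noncomputable section

namespace Summit.AtomisticToContinuum.Crystallization.Theorems.FrustratedLawDichotomyCapMatchCert

open Literature.Geometry.DiscreteGeometry
open Summit.AtomisticToContinuum.Crystallization.Theses.PricedLinkCensus (ChargedEnergyGap)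
open Summit.AtomisticToContinuum.Crystallization.Theorems.FrustratedLawDichotomyTwoShellRigidityCut
  (E3 LinkIso Capped CapForcingAt CapForcing KR2Shape kr2Shape_of_cut aperiodicFrustratedLawGap_of_cut
    noFrustratedPeriodicMinimiser_of_cut)
open Summit.AtomisticToContinuum.Crystallization.Theorems.FrustratedLawDichotomyCappedRigidityCert (CappedCert)
open Summit.AtomisticToContinuum.Crystallization.Theorems.FrustratedLawDichotomyCappedRigidityCertPatterns
  (cappedRigidity_of_cert fcc_contactSeparating hcp_contactSeparating)
open Summit.AtomisticToContinuum.Crystallization.Theorems.FrustratedLawDichotomyLinkCert (LinkCert linkClassification_of_linkCert)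
open Summit.AtomisticToContinuum.Crystallization.Theorems.FrustratedLawDichotomyBondGraphWindows
  (one_add_pos_of_adj dist_le_mul_dist_of_adj min_dist_lt_dist_of_not_adj)
open Summit.AtomisticToContinuum.Crystallization.Theorems.FrustratedLawDichotomyNoTwistCert (BondLike NoTwistCert)
open Summit.AtomisticToContinuum.Crystallization.Theorems.FrustratedLawDichotomyCornerPairingHalfCap (hcp_ncard_common_contacts_of_diagonal)
open Summit.AtomisticToContinuum.Crystallization.Theorems.FrustratedLawDichotomyHalfCap
  (fcc_ncard_common_contacts_of_diagonal exists_halfCap_of_noTwist_fcc exists_halfCap_of_noTwist_hcp)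

/-- **`CapMatchCert θ Pat` — the finite «cap match» statement** (see the module docstring). [certificate target; lens-5 NODE §4: both
half-caps lie on the cap circle within `±3.4°` of the cap position at `θ = 1/100`, so two distinct ones would violate separation] -/
def CapMatchCert (θ : ℝ) (Pat : Finset E3) : Prop :=
  ∀ (p : ↥Pat → E3) (a b w₁ w₂ : ↥Pat) (m₁ m₂ : E3),
    dist (a : E3) (b : E3) = Real.sqrt 2 → dist (a : E3) (w₁ : E3) = 1 → dist (b : E3) (w₁ : E3) = 1 →
    dist (a : E3) (w₂ : E3) = 1 → dist (b : E3) (w₂ : E3) = 1 → w₁ ≠ w₂ →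
    -- the centre's link
    (∀ u : ↥Pat, 1 ≤ ‖p u‖ ∧ ‖p u‖ ≤ 1 + θ) → Function.Injective p →
    (∀ u : ↥Pat, BondLike θ (insert 0 (Set.range p ∪ {m₁, m₂})) 0 (p u)) →
    (∀ u v : ↥Pat, dist (u : E3) (v : E3) = 1 → BondLike θ (insert 0 (Set.range p ∪ {m₁, m₂})) (p u) (p v)) →
    (∀ u v : ↥Pat, u ≠ v → dist (u : E3) (v : E3) ≠ 1 → min ‖p u‖ ‖p v‖ < ‖p u - p v‖) →
    -- the two half-caps
    m₁ ∉ Set.range p → m₂ ∉ Set.range p → m₁ ≠ 0 → m₂ ≠ 0 →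
    BondLike θ (insert 0 (Set.range p ∪ {m₁, m₂})) m₁ (p a) → BondLike θ (insert 0 (Set.range p ∪ {m₁, m₂})) m₁ (p b) →
    BondLike θ (insert 0 (Set.range p ∪ {m₁, m₂})) m₁ (p w₁) →
    BondLike θ (insert 0 (Set.range p ∪ {m₁, m₂})) m₂ (p a) → BondLike θ (insert 0 (Set.range p ∪ {m₁, m₂})) m₂ (p b) →
    BondLike θ (insert 0 (Set.range p ∪ {m₁, m₂})) m₂ (p w₂) →
    (∀ u : ↥Pat, min ‖p u‖ ‖m₁ - p a‖ < ‖m₁‖) → (∀ u : ↥Pat, min ‖p u‖ ‖m₂ - p a‖ < ‖m₂‖) →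
    -- undetermined pairs
    (∀ u : ↥Pat, BondLike θ (insert 0 (Set.range p ∪ {m₁, m₂})) m₁ (p u) ∨ min ‖m₁ - p a‖ ‖p u‖ < ‖m₁ - p u‖) →
    (∀ u : ↥Pat, BondLike θ (insert 0 (Set.range p ∪ {m₁, m₂})) m₂ (p u) ∨ min ‖m₂ - p a‖ ‖p u‖ < ‖m₂ - p u‖) →
    (m₁ ≠ m₂ → BondLike θ (insert 0 (Set.range p ∪ {m₁, m₂})) m₁ m₂ ∨ min ‖m₁ - p a‖ ‖m₂ - p a‖ < ‖m₁ - m₂‖) →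
    m₁ = m₂

/-- **`P` at one pattern from finite certificates**: `NoTwistCert θ Pat fcc ∧ NoTwistCert θ Pat hcp ∧ CapMatchCert θ Pat ⟹ CapForcingAt θ Pat`
for a pattern whose contact graph separates points and whose diagonal pairs have exactly two common contacts (fcc, hcp). [folklore] -/
theorem capForcingAt_of_certs {θ : ℝ} {Pat : Finset E3}
    (hPat : ∀ u v : ↥Pat, u ≠ v → ∃ c : ↥Pat, dist (u : E3) (c : E3) = 1 ∧ dist (v : E3) (c : E3) ≠ 1)
    (hsq : ∀ a b : ↥Pat, dist (a : E3) (b : E3) = Real.sqrt 2 →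
      ({c : ↥Pat | dist (a : E3) (c : E3) = 1} ∩ {c : ↥Pat | dist (b : E3) (c : E3) = 1}).ncard = 2)
    (hNf : NoTwistCert θ Pat fccKissingPattern) (hNh : NoTwistCert θ Pat hcpKissingPattern) (hCM : CapMatchCert θ Pat) :
    CapForcingAt θ Pat := by
  classical
  intro N y i τ hy _hsep _hcf _hcf2 hL hnb u v huv
  -- the two common contacts w₁ ≠ w₂ of the diagonal pair {u, v}
  obtain ⟨w₁, w₂, hw12, hS⟩ := Set.ncard_eq_two.1 (hsq u v huv)
  have hw₁ : w₁ ∈ ({c : ↥Pat | dist (u : E3) (c : E3) = 1} ∩ {c : ↥Pat | dist (v : E3) (c : E3) = 1}) := by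
    rw [hS]; simp
  have hw₂ : w₂ ∈ ({c : ↥Pat | dist (u : E3) (c : E3) = 1} ∩ {c : ↥Pat | dist (v : E3) (c : E3) = 1}) := by
    rw [hS]; simp
  obtain ⟨hw₁u, hw₁v⟩ := hw₁
  obtain ⟨hw₂u, hw₂v⟩ := hw₂
  have hw₁u' : dist (w₁ : E3) (u : E3) = 1 := by rw [dist_comm]; exact hw₁u
  have hw₁v' : dist (w₁ : E3) (v : E3) = 1 := by rw [dist_comm]; exact hw₁v
  have hw₂u' : dist (w₂ : E3) (u : E3) = 1 := by rw [dist_comm]; exact hw₂u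
  have hw₂v' : dist (w₂ : E3) (v : E3) = 1 := by rw [dist_comm]; exact hw₂v
  -- half-caps from both corners
  have halfCap : ∀ w : ↥Pat, dist (w : E3) (u : E3) = 1 → dist (w : E3) (v : E3) = 1 →
      ∃ m : Fin N, m ≠ i ∧ (bondGraph θ y).Adj m (τ u) ∧ (bondGraph θ y).Adj m (τ v) ∧ (bondGraph θ y).Adj m (τ w) ∧
        m ∉ Set.range τ := by
    intro w hwu hwv
    rcases hnb (τ w) (hL.1 w) with ⟨τ', hL'⟩ | ⟨τ', hL'⟩
    · obtain ⟨w', hw'⟩ := hL'.2.1 i (hL.1 w).symm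
      exact exists_halfCap_of_noTwist_fcc hPat hNf hy hL w hL' hw' hwu hwv huv
    · obtain ⟨w', hw'⟩ := hL'.2.1 i (hL.1 w).symm
      exact exists_halfCap_of_noTwist_hcp hPat hNh hy hL w hL' hw' hwu hwv huv
  obtain ⟨m₁, hm₁i, hm₁u, hm₁v, hm₁w, hm₁r⟩ := halfCap w₁ hw₁u' hw₁v'
  obtain ⟨m₂, hm₂i, hm₂u, hm₂v, hm₂w, hm₂r⟩ := halfCap w₂ hw₂u' hw₂v'
  -- it suffices that the two half-caps coincide
  suffices hmm : m₁ = m₂ by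
    refine ⟨m₁, hm₁i, fun w hw => ?_⟩
    rcases hw with rfl | rfl | ⟨hwu, hwv⟩
    · exact hm₁u
    · exact hm₁v
    · have hmem : w ∈ ({c : ↥Pat | dist (u : E3) (c : E3) = 1} ∩ {c : ↥Pat | dist (v : E3) (c : E3) = 1}) :=
        ⟨by show dist (u : E3) (w : E3) = 1; rw [dist_comm]; exact hwu,
         by show dist (v : E3) (w : E3) = 1; rw [dist_comm]; exact hwv⟩
      rw [hS] at hmem
      simp only [Set.mem_insert_iff, Set.mem_singleton_iff] at hmem
      rcases hmem with rfl | rfl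
      · exact hm₁w
      · rw [hmm]; exact hm₂w
  -- the finite «cap match»: rescale and read off the windows
  have hτ : Function.Injective τ := FrustratedLawDichotomyLinkIsoToolkit.injective_of_linkIso hPat hL
  have hθpos : 0 < 1 + θ := one_add_pos_of_adj hy (hL.1 u)
  have hθ : 0 ≤ 1 + θ := hθpos.le
  set r : ℝ := nearestDist y i with hr_def
  have hui : τ u ≠ i := fun h => (hL.1 u).ne h.symm
  have hr0 : 0 < r := by
    obtain ⟨k₀, hk₀, hr⟩ := exists_nearestDist_eq_dist y (j := i) ⟨τ u, hui⟩
    rw [hr_def, hr]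
    exact dist_pos.2 fun h => hk₀ (hy h).symm
  have hri : 0 < r⁻¹ := inv_pos.2 hr0
  set q : Fin N → E3 := fun j => r⁻¹ • (y j - y i) with hq_def
  have hq_sub : ∀ j l, ‖q j - q l‖ = r⁻¹ * dist (y j) (y l) := by
    intro j l
    simp only [hq_def]
    rw [← smul_sub, sub_sub_sub_cancel_right, norm_smul, Real.norm_of_nonneg hri.le, dist_eq_norm]
  have hqi : q i = 0 := by simp [hq_def]
  have hq_norm : ∀ j, ‖q j‖ = r⁻¹ * dist (y j) (y i) := by
    intro j
    have := hq_sub j i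
    rwa [hqi, sub_zero] at this
  have hq_inj : Function.Injective q := by
    intro j l h
    have h0 : ‖q j - q l‖ = 0 := by rw [h, sub_self, norm_zero]
    rw [hq_sub] at h0
    rcases mul_eq_zero.1 h0 with h1 | h1
    · exact absurd h1 hri.ne'
    · exact hy (dist_eq_zero.1 h1)
  have sA : ∀ j, j ≠ i → 1 ≤ ‖q j‖ := by
    intro j hj
    rw [hq_norm, dist_comm]
    have := nearestDist_le_dist y hj
    rw [← hr_def] at this
    calc (1 : ℝ) = r⁻¹ * r := by field_simp
      _ ≤ r⁻¹ * dist (y i) (y j) := mul_le_mul_of_nonneg_left this hri.le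
  have sR : ∀ j, (bondGraph θ y).Adj i j → ‖q j‖ ≤ 1 + θ := by
    intro j hj
    rw [hq_norm, dist_comm]
    have h1 : dist (y i) (y j) ≤ (1 + θ) * r := dist_le_of_adj hθ hj
    calc r⁻¹ * dist (y i) (y j) ≤ r⁻¹ * ((1 + θ) * r) := mul_le_mul_of_nonneg_left h1 hri.le
      _ = 1 + θ := by field_simp
  have sB : ∀ j k l, (bondGraph θ y).Adj j k → l ≠ j → ‖q j - q k‖ ≤ (1 + θ) * ‖q j - q l‖ := by
    intro j k l hjk hlj
    rw [hq_sub, hq_sub]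
    calc r⁻¹ * dist (y j) (y k) ≤ r⁻¹ * ((1 + θ) * dist (y j) (y l)) :=
          mul_le_mul_of_nonneg_left (dist_le_mul_dist_of_adj hθ hjk hlj) hri.le
      _ = (1 + θ) * (r⁻¹ * dist (y j) (y l)) := by ring
  have sB' : ∀ j k l, (bondGraph θ y).Adj j k → l ≠ k → ‖q j - q k‖ ≤ (1 + θ) * ‖q k - q l‖ := by
    intro j k l hjk hlk
    rw [norm_sub_rev (q j)]
    exact sB k j l hjk.symm hlk
  have sN : ∀ j k j' k', j ≠ k → ¬ (bondGraph θ y).Adj j k → (bondGraph θ y).Adj j j' → (bondGraph θ y).Adj k k' →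
      min ‖q j - q j'‖ ‖q k - q k'‖ < ‖q j - q k‖ := by
    intro j k j' k' hjk hnot hj hk
    rw [hq_sub, hq_sub, hq_sub, ← mul_min_of_nonneg _ _ hri.le]
    exact mul_lt_mul_of_pos_left (min_dist_lt_dist_of_not_adj hθ hjk hnot hj hk) hri
  -- the finite data
  set p : ↥Pat → E3 := fun z => q (τ z) with hp_def
  set K : Set E3 := insert 0 (Set.range p ∪ {q m₁, q m₂}) with hK_def
  have hK : ∀ {Z} {j : Fin N}, Z ∈ K → Z ≠ q j → ∃ l, l ≠ j ∧ q l = Z := by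
    intro Z j hZ hne
    rcases hZ with rfl | hZ
    · exact ⟨i, fun h => hne (by rw [← h, hqi]), hqi⟩
    rcases hZ with ⟨z, rfl⟩ | hZ
    · exact ⟨τ z, fun h => hne (by simp [hp_def, h]), rfl⟩
    · simp only [Set.mem_insert_iff, Set.mem_singleton_iff] at hZ
      rcases hZ with rfl | rfl
      · exact ⟨m₁, fun h => hne (by rw [h]), rfl⟩
      · exact ⟨m₂, fun h => hne (by rw [h]), rfl⟩
  have bondLike : ∀ {j k : Fin N}, (bondGraph θ y).Adj j k → BondLike θ K (q j) (q k) := by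
    intro j k hjk
    refine ⟨fun Z hZ hne => ?_, fun Z hZ hne => ?_⟩
    · obtain ⟨l, hl, rfl⟩ := hK hZ hne
      exact sB j k l hjk hl
    · obtain ⟨l, hl, rfl⟩ := hK hZ hne
      exact sB' j k l hjk hl
  have hτi : ∀ z, τ z ≠ i := fun z h => (hL.1 z).ne h.symm
  have notRange : ∀ {m : Fin N}, m ∉ Set.range τ → q m ∉ Set.range p := by
    intro m hm ⟨z, hz⟩
    exact hm ⟨z, hq_inj (by simpa [hp_def] using hz)⟩
  have notAdj_i : ∀ {m : Fin N}, m ∉ Set.range τ → ¬ (bondGraph θ y).Adj i m := by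
    intro m hm h
    obtain ⟨z, hz⟩ := hL.2.1 _ h
    exact hm ⟨z, hz⟩
  have undet : ∀ (m : Fin N) (z : ↥Pat), m ∉ Set.range τ → (bondGraph θ y).Adj m (τ u) →
      BondLike θ K (q m) (p z) ∨ min ‖q m - p u‖ ‖p z‖ < ‖q m - p z‖ := by
    intro m z hm hmu
    by_cases hadj : (bondGraph θ y).Adj m (τ z)
    · exact Or.inl (bondLike hadj)
    · have hmz : m ≠ τ z := fun h => hm ⟨z, h.symm⟩
      right
      have := sN m (τ z) (τ u) i hmz hadj hmu (hL.1 z).symm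
      simpa [hqi, hp_def] using this
  have hqq : q m₁ = q m₂ := hCM p u v w₁ w₂ (q m₁) (q m₂) huv hw₁u hw₁v hw₂u hw₂v hw12
    (fun z => ⟨sA _ (hτi z), sR _ (hL.1 z)⟩) (hq_inj.comp hτ)
    (fun z => by have := bondLike (hL.1 z); rwa [hqi] at this)
    (fun z z' hzz => bondLike ((hL.2.2 z z').2 hzz))
    (fun z z' hzz hd => by
      have hnot : ¬ (bondGraph θ y).Adj (τ z) (τ z') := fun h => hd ((hL.2.2 z z').1 h)
      have := sN (τ z) (τ z') i i (hτ.ne hzz) hnot (hL.1 z).symm (hL.1 z').symm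
      simpa [hqi] using this)
    (notRange hm₁r) (notRange hm₂r)
    (by rw [← hqi]; exact fun h => hm₁i (hq_inj h)) (by rw [← hqi]; exact fun h => hm₂i (hq_inj h))
    (bondLike hm₁u) (bondLike hm₁v) (bondLike hm₁w) (bondLike hm₂u) (bondLike hm₂v) (bondLike hm₂w)
    (fun z => by
      have := sN i m₁ (τ z) (τ u) hm₁i.symm (notAdj_i hm₁r) (hL.1 z) hm₁u
      rw [hqi, zero_sub, norm_neg, zero_sub, norm_neg] at this
      simpa [hp_def] using this)
    (fun z => by
      have := sN i m₂ (τ z) (τ u) hm₂i.symm (notAdj_i hm₂r) (hL.1 z) hm₂u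
      rw [hqi, zero_sub, norm_neg, zero_sub, norm_neg] at this
      simpa [hp_def] using this)
    (fun z => undet m₁ z hm₁r hm₁u) (fun z => undet m₂ z hm₂r hm₂u)
    (fun hne => by
      have hne' : m₁ ≠ m₂ := fun h => hne (by rw [h])
      by_cases hadj : (bondGraph θ y).Adj m₁ m₂
      · exact Or.inl (bondLike hadj)
      · right
        have := sN m₁ m₂ (τ u) (τ u) hne' hadj hm₁u hm₂u
        simpa [hp_def] using this)
  exact hq_inj hqq

/-- **`CapForcing θ` from the six finite P-certificates.** [folklore] -/
theorem capForcing_of_certs {θ : ℝ}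
    (hNff : NoTwistCert θ fccKissingPattern fccKissingPattern) (hNfh : NoTwistCert θ fccKissingPattern hcpKissingPattern)
    (hNhf : NoTwistCert θ hcpKissingPattern fccKissingPattern) (hNhh : NoTwistCert θ hcpKissingPattern hcpKissingPattern)
    (hCf : CapMatchCert θ fccKissingPattern) (hCh : CapMatchCert θ hcpKissingPattern) : CapForcing θ :=
  ⟨capForcingAt_of_certs fcc_contactSeparating fcc_ncard_common_contacts_of_diagonal hNff hNfh hCf,
   capForcingAt_of_certs hcp_contactSeparating hcp_ncard_common_contacts_of_diagonal hNhf hNhh hCh⟩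

/-- ★ **`KR2Shape` FROM NINE FINITE CERTIFICATES**: `LinkCert(1/100)` (G), the six P-certificates, `CappedCert(1/100, 1/20, fcc/hcp)` (M).
The geometric side of the dichotomy column `FDG ⟸ ChargedEnergyGap ∧ KR2_shape` is a conjunction of finite statements. [folklore] -/
theorem kr2Shape_of_finiteCerts (hG : LinkCert (1 / 100))
    (hNff : NoTwistCert (1 / 100) fccKissingPattern fccKissingPattern) (hNfh : NoTwistCert (1 / 100) fccKissingPattern hcpKissingPattern)
    (hNhf : NoTwistCert (1 / 100) hcpKissingPattern fccKissingPattern) (hNhh : NoTwistCert (1 / 100) hcpKissingPattern hcpKissingPattern)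
    (hCf : CapMatchCert (1 / 100) fccKissingPattern) (hCh : CapMatchCert (1 / 100) hcpKissingPattern)
    (hMf : CappedCert (1 / 100) (1 / 20) fccKissingPattern) (hMh : CappedCert (1 / 100) (1 / 20) hcpKissingPattern) : KR2Shape :=
  kr2Shape_of_cut (linkClassification_of_linkCert hG) (capForcing_of_certs hNff hNfh hNhf hNhh hCf hCh)
    (cappedRigidity_of_cert hMf hMh)

/-- **`AperiodicFrustratedLawGap` (crux of item 27623) BY NAME from `MuEquilibriumDoor ∧ ChargedEnergyGap` and the nine finite certificates.**
[folklore] -/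
theorem aperiodicFrustratedLawGap_of_finiteCerts
    (hDoor : Summit.AtomisticToContinuum.Crystallization.Theses.GrainCoreNetworkSplit.MuEquilibriumDoor) (hgap : ChargedEnergyGap)
    (hG : LinkCert (1 / 100))
    (hNff : NoTwistCert (1 / 100) fccKissingPattern fccKissingPattern) (hNfh : NoTwistCert (1 / 100) fccKissingPattern hcpKissingPattern)
    (hNhf : NoTwistCert (1 / 100) hcpKissingPattern fccKissingPattern) (hNhh : NoTwistCert (1 / 100) hcpKissingPattern hcpKissingPattern)
    (hCf : CapMatchCert (1 / 100) fccKissingPattern) (hCh : CapMatchCert (1 / 100) hcpKissingPattern)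
    (hMf : CappedCert (1 / 100) (1 / 20) fccKissingPattern) (hMh : CappedCert (1 / 100) (1 / 20) hcpKissingPattern) :
    Summit.AtomisticToContinuum.Crystallization.Theses.FrustratedLawDichotomy.AperiodicFrustratedLawGap :=
  aperiodicFrustratedLawGap_of_cut hDoor hgap (linkClassification_of_linkCert hG)
    (capForcing_of_certs hNff hNfh hNhf hNhh hCf hCh) (cappedRigidity_of_cert hMf hMh)

/-- **Item 26654 `NoFrustratedPeriodicMinimiser`, door-free, from `ChargedEnergyGap` and the nine finite certificates.** [folklore] -/
theorem noFrustratedPeriodicMinimiser_of_finiteCerts (hgap : ChargedEnergyGap) (hG : LinkCert (1 / 100))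
    (hNff : NoTwistCert (1 / 100) fccKissingPattern fccKissingPattern) (hNfh : NoTwistCert (1 / 100) fccKissingPattern hcpKissingPattern)
    (hNhf : NoTwistCert (1 / 100) hcpKissingPattern fccKissingPattern) (hNhh : NoTwistCert (1 / 100) hcpKissingPattern hcpKissingPattern)
    (hCf : CapMatchCert (1 / 100) fccKissingPattern) (hCh : CapMatchCert (1 / 100) hcpKissingPattern)
    (hMf : CappedCert (1 / 100) (1 / 20) fccKissingPattern) (hMh : CappedCert (1 / 100) (1 / 20) hcpKissingPattern) :
    Summit.AtomisticToContinuum.Crystallization.Theses.PeriodicChargeSplit.NoFrustratedPeriodicMinimiser :=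
  noFrustratedPeriodicMinimiser_of_cut hgap (linkClassification_of_linkCert hG)
    (capForcing_of_certs hNff hNfh hNhf hNhh hCf hCh) (cappedRigidity_of_cert hMf hMh)

end Summit.AtomisticToContinuum.Crystallization.Theorems.FrustratedLawDichotomyCapMatchCert

end
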